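import Literature.Probability.Percolation.OneArmQuasiMult
import Literature.Probability.Percolation.NearCriticalCorrelationLengthLower
import HarnessLib

/-!
# Quasi-multiplicativity and extendability of the one-arm event below `L_ε(p)`, on both sides of `1/2` (proofs only)

Topic `Literature/Probability/Percolation`; family `crit-perc`, statement **crit-perc.S16**
(`Literature.Probability.Percolation.triTheta_exponent`). Proofs only (no new definition, no new
named fact). A brick of Kesten's near-critical theory for the named fact `Nolin2008_thm27_oneArm`
(`NearCriticalScaling.lean`; P. Nolin, *Near-critical percolation in two dimensions*, Electron. J.
Probab. 13 (2008), §6.1, Thm. 27 [arXiv 0711.4948: Thm. 26], `j = 1`), namely the input of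
Case 1 of its proof, eq. (6.6):

  `P̃_t(∂S_{2^{k₀}} ↝ ∂S_{2^l}) · P̃_t(∂S_{2^{l+3}} ↝ ∂S_{2^K}) ≤ C₂ P̃_t(∂S_{2^{k₀}} ↝ ∂S_{2^K})`,

with Nolin's footnote "in the case of one arm, the extendability property, as well as the
quasi-multiplicativity, are direct consequences of RSW and do not require the separation lemmas"
(§4.5, Props. 16–17 [arXiv: Props. 15–16] for `j = 1`, stated there for all `P̂` between `P_p` and
`P_{1-p}` and radii `≤ L(p)`). The tree's `OneArmQuasiMult.lean` proves it for the homogeneous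
measures `P_t`, `t ≥ 1/2`, at all scales (open circuits are increasing, so RSW at `1/2` suffices).
Here the SUB-CRITICAL side is added: for `t < 1/2` the open colour is sub-critical and RSW holds
only below the characteristic length `L_ε(t)` (Nolin, §3.1, (3.5)–(3.6): by the very definition of
`L_ε`, rhombi of side `< L_ε(t)` are crossed with probability `> ε`, and the RSW theorem at general
`p`, his Thm. 2, turns this into crossings of long parallelograms and circuits in annuli). The RSW
theorem at general `p` is the tree's two-scale theorem `TriHexagon.triLRCrossingProb_two_scale`
(Bollobás–Riordan's Lemma 4 / Cor. 5 in lattice hexagons, `TriRSWTwoScale.lean`), as already used at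
the top scale `L_ε - 1` in `exists_pow_le_triLRCrossingProb_holds` (`NearCriticalCorrelationLengthLower.lean`).

## Contents (all proved)

* `exists_pow_le_triLRCrossingProb_below` — **RSW below `L_ε` at every scale**: for `ε ∈ (0, 1/2)`
  there is `η = η(ε) > 0` with `η^j ≤ P_q(LR(w, h))` for every `p`, every `q ≥ min(p, 1 - p)`, every
  height `1 ≤ h < L_ε(p)` and width `w ≤ (j + 1) h` (the tree's statement is the case `h = L_ε - 1`).
* `exists_pos_le_triLRCrossingProb_seven` — the aspect-ratio-`7` bound `c ≤ P_t(LR(7k, k))` for all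
  `t`, all `k ≥ 1`, with `k < L_ε(t)` required only when `t < 1/2` (for `t ≥ 1/2`, RSW at `1/2` and
  monotonicity).
* `pow_six_le_real_iInter_isoTBCrossing_at`, `pow_six_le_real_triOpenCircuit` — Bollobás–Riordan's
  six-piece circuit (Ch. 7, proof of Lemma 4) at EVERY density: `P_p(LR(7k, k))⁶ ≤ P_p(A(R, 2R))`,
  `k = ⌊7R/25⌋`, `R ≥ 1000` (`A = triOpenCircuit`; the tree's `BollobasRiordan2006_openCircuit_of_rsw`
  is the case `p = 1/2`).
* `exists_pos_le_triOpenCircuit_nearCritical`, `exists_pos_le_triOpenCrossing_four_nearCritical` —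
  open circuits in `A(R, 2R)` and open crossings `C(b, 4b)` with probability `≥ c(ε)` for all `t`,
  below `L_ε(t)` when `t < 1/2` (`R ≤ 3 L_ε(t)`, resp. `b ≤ L_ε(t)`).
* `triOneArm_quasiMult_of_bounds` — the deterministic-plus-Harris gluing of
  `triOneArm_quasiMult_euclid` with the five RSW inputs (three circuits, two crossings) as explicit
  lower-bound hypotheses at the parameter `t` (LSW 2002, §3; Nolin (6.6)).
* `triOneArm_quasiMult_euclid_nearCritical`, `triOneArm_quasiMult_nearCritical`,
  `triOneArm_extend_nearCritical` — **quasi-multiplicativity and extendability of the open arm for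
  all `t`, below `L_ε(t)` on the sub-critical side**: there is `c = c(ε) > 0` such that for all `t`,
  all integers `a ≥ 1000` with `2a ≤ L_ε(t)` if `t < 1/2` (resp. `4a ≤ L_ε(t)` for extendability),
  all `R ≥ 8a`, `n ≤ R`, `m ≥ 3a`:
  `c · P_t(0 ↔ ∂Λ_m) · P_t(C(4a, R)) ≤ P_t(0 ↔ ∂Λ_n)` and `c · P_t(0 ↔ ∂Λ_m) ≤ P_t(0 ↔ ∂Λ_{n'})`
  for `n' ≤ 8a`.

## References

* P. Nolin, Near-critical percolation in two dimensions, *Electron. J. Probab.* 13 (2008), §3.1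
  (definition of `L_ε`, (3.5)–(3.6)), Thm. 2 (RSW), §4.5 Props. 16–17, §6.2 proof of Thm. 27,
  Case 1, eq. (6.6) and footnote [arXiv 0711.4948: Props. 15–16, Thm. 26] [Nolin2008].
* B. Bollobás, O. Riordan, *Percolation* (2006), Ch. 3, Lemma 4 and Cor. 5; Ch. 7, §7.2.1, proof
  of Lemma 4 [BollobasRiordan2006].
* G. Lawler, O. Schramm, W. Werner, One-arm exponent for critical 2D percolation, *Electron. J.
  Probab.* 7 (2002), §3 [LawlerSchrammWernerEJP2002].
* H. Kesten, Scaling relations for 2D-percolation, *Comm. Math. Phys.* 109 (1987) [KestenScalingCMP1987].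

Tree: `TriHexagon.triLRCrossingProb_two_scale` (`TriRSWTwoScale.lean`),
`pow_mul_pow_le_triLRCrossingProb_of_le` (`TriRSWChaining.lean`), `triLRCrossingProb_le_mul`,
`pow_succ_le_triLRCrossingProb` (`NearCriticalCorrelationLengthLower.lean`),
`lt_triLRCrossingProb_of_lt_charLength` (`KestenScaling.lean`), `isoTBCrossing`, `pieceIso`,
`piece_subset_box`, `exists_circuit_of_crossings`, `mem_triOpenCircuit_of_circuit`,
`triSitePercolation_real_isoTBCrossing` (`TriAnnulusCircuit.lean`), `triOneArm_of_glue`,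
`triTBCrossing_subset_triOpenCrossing` (`OneArmQuasiMult.lean`), `tri_rsw_half_holds`
(`TriThetaHalf.lean`), `sitePercolation_real_inter_iInter_ge`, `determinedBy_triOpenCrossing`,
`determinedBy_triOpenCircuit`, `subset_box_of_norm_le`, `triOneArm_subset_triOpenCrossing`
(`OneArmLSW.lean`), `sitePercolation_harris` (`SitePercolationMeasure.lean`).
-/

noncomputable section

open MeasureTheory Set
open scoped unitInterval

namespace Literature.Probability.Percolation

open LatticeModels

/-! ### RSW below `L_ε` at every scale -/

/-- **RSW below the characteristic length, at every scale** (Nolin 2008, §3.1, (3.5)–(3.6) with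
Thm. 2; Bollobás–Riordan 2006, Ch. 3, Lemma 4 / Cor. 5 run at every density): for `ε ∈ (0, 1/2)`
there is `η ∈ (0, 1]` such that for every `p`, every `q ≥ min(p, 1 - p)`, every height
`1 ≤ h < L_ε(p)` and every `j ≥ 1`, the `w × h` parallelogram, `w ≤ (j + 1) h`, is crossed the long
way at `q` with probability `≥ η^j`. Proof: all rhombi of side `≤ h` lie below `L_ε(p)`, hence are
crossed with probability `> ε` (`lt_triLRCrossingProb_of_lt_charLength`), also at `q`; for `h ≥ 6`
the two-scale RSW theorem at the height `4j₀ + 2 ∈ (h/2, h]` and chaining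
(`pow_mul_pow_le_triLRCrossingProb_of_le`), then monotonicity in the height; for `h ≤ 5` the open
bottom row (`q > ε/6`). Verbatim the tree's `exists_pow_le_triLRCrossingProb_holds` (the case
`h = L_ε(p) - 1`). [cite: Nolin2008, §3.1, (3.5)–(3.6)] [cite: BollobasRiordan2006, Ch. 3 Lemma 4, Cor. 5] -/
theorem exists_pow_le_triLRCrossingProb_below {ε : ℝ} (hε : 0 < ε) (hε' : ε < 1 / 2) :
    ∃ η : ℝ, 0 < η ∧ η ≤ 1 ∧ ∀ (p q : unitInterval), min p (σ p) ≤ q →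
      ∀ h : ℕ, 1 ≤ h → h < charLength ε p →
        ∀ (j w : ℕ), 1 ≤ j → w ≤ (j + 1) * h → η ^ j ≤ triLRCrossingProb q w h := by
  have hε1 : ε ≤ 1 := by linarith
  obtain ⟨δ₁, hδ₁⟩ : ∃ δ₁ : ℝ, δ₁ = (ε / 2) ^ 396 := ⟨_, rfl⟩
  have hδ₁0 : 0 < δ₁ := by rw [hδ₁]; positivity
  have hδ₁1 : δ₁ ≤ 1 := by rw [hδ₁]; exact pow_le_one₀ (by positivity) (by linarith)
  set η : ℝ := min (δ₁ ^ 3 * ε ^ 2) ((ε / 6) ^ 11) with hη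
  have hη0 : 0 < η := lt_min (by positivity) (by positivity)
  have hη1 : η ≤ 1 := (min_le_left _ _).trans (by
    calc δ₁ ^ 3 * ε ^ 2 ≤ 1 ^ 3 * 1 ^ 2 := by gcongr
      _ = 1 := by norm_num)
  refine ⟨η, hη0, hη1, ?_⟩
  intro p q hq h hh1 hhL j w hj hw
  -- crossing probabilities at all scales `≤ h < L` exceed `ε`, also at `q`
  have hscale : ∀ m : ℕ, m ≤ h → ε ≤ triLRCrossingProb q m m := fun m hm =>
    (lt_triLRCrossingProb_of_lt_charLength (by omega : m < charLength ε p)).le.trans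
      (TriHexExclusive.triLRCrossingProb_mono hq m m)
  by_cases hbig : 6 ≤ h
  · -- two-scale RSW at height `n = 4 j₀ + 2 ≤ h`, then chaining and monotonicity in the height
    set j₀ : ℕ := (h - 2) / 4 with hj₀
    have hj₀1 : 1 ≤ j₀ := by omega
    set n : ℕ := 4 * j₀ + 2 with hn
    have hnh : n ≤ h := by omega
    have hhn : h ≤ 2 * n := by omega
    have h2 : δ₁ ≤ triLRCrossingProb q (2 * n) n := by
      have := TriHexagon.triLRCrossingProb_two_scale q hj₀1 hε.le (hscale (2 * j₀) (by omega))
        (hscale n hnh)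
      rw [hδ₁]; convert this using 2; omega
    have hchain := pow_mul_pow_le_triLRCrossingProb_of_le q n hδ₁0.le hε.le h2 (hscale n hnh)
      (j := 2 * j + 1) (by omega) (w := w) (by nlinarith)
    calc η ^ j ≤ (δ₁ ^ 3 * ε ^ 2) ^ j := pow_le_pow_left₀ hη0.le (min_le_left _ _) j
      _ = δ₁ ^ (3 * j) * ε ^ (2 * j) := by ring
      _ ≤ δ₁ ^ (2 * j + 1) * ε ^ (2 * j + 1 - 1) := by
          rw [show 2 * j + 1 - 1 = 2 * j from by omega]
          exact mul_le_mul_of_nonneg_right (pow_le_pow_of_le_one hδ₁0.le hδ₁1 (by omega))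
            (by positivity)
      _ ≤ triLRCrossingProb q w n := hchain
      _ ≤ triLRCrossingProb q w h := triLRCrossingProb_mono_height q w hnh
  · -- small heights: `q > ε / 6` and the open bottom row
    have hh5 : h ≤ 5 := by omega
    have hqε : ε / 6 ≤ q := by
      have h1 : ε ≤ (h + 1) * (q : ℝ) := (hscale h le_rfl).trans (triLRCrossingProb_le_mul q h h)
      have h6 : ((h : ℝ) + 1) ≤ 6 := by exact_mod_cast (by omega : h + 1 ≤ 6)
      have hq0 : 0 ≤ (q : ℝ) := q.2.1
      nlinarith
    have hw' : w + 1 ≤ 11 * j := by nlinarith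
    calc η ^ j ≤ ((ε / 6) ^ 11) ^ j := pow_le_pow_left₀ hη0.le (min_le_right _ _) j
      _ = (ε / 6) ^ (11 * j) := by rw [← pow_mul]
      _ ≤ (ε / 6) ^ (w + 1) := pow_le_pow_of_le_one (by positivity) (by linarith) hw'
      _ ≤ (q : ℝ) ^ (w + 1) := pow_le_pow_left₀ (by positivity) hqε _
      _ ≤ triLRCrossingProb q w h := pow_succ_le_triLRCrossingProb q w h

/-- **The aspect-ratio-`7` RSW bound for the open colour, all `t`, below `L_ε(t)` on the
sub-critical side**: for `ε ∈ (0, 1/2)` there is `c > 0` with `c ≤ P_t(LR(7k, k))` for every `t`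
and every `k ≥ 1`, provided `k < L_ε(t)` when `t < 1/2` (where the open colour is sub-critical:
`exists_pow_le_triLRCrossingProb_below` at `p = q = t`, `j = 6`); for `t ≥ 1/2` this is RSW at
`1/2` (`tri_rsw_half_holds`, aspect ratio `7`) and monotonicity in `t`. [cite: Nolin2008, §3.1, (3.5)–(3.6)] [cite: WernerPCMI2009, Lecture 6, §3 (uniform RSW estimates for n ≤ L(p))] -/
theorem exists_pos_le_triLRCrossingProb_seven {ε : ℝ} (hε : 0 < ε) (hε' : ε < 1 / 2) :
    ∃ c > (0 : ℝ), ∀ t : unitInterval, ∀ k : ℕ, 1 ≤ k →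
      ((t : ℝ) < 1 / 2 → k < charLength ε t) → c ≤ triLRCrossingProb t (7 * k) k := by
  obtain ⟨η, hη0, -, hη⟩ := exists_pow_le_triLRCrossingProb_below hε hε'
  obtain ⟨c₇, hc₇, h₇⟩ := tri_rsw_half_holds 7 (by norm_num)
  refine ⟨min (η ^ 6) c₇, lt_min (by positivity) hc₇, fun t k hk hkL => ?_⟩
  rcases lt_or_ge (t : ℝ) (1 / 2) with hlt | hge
  · -- sub-critical side: RSW below `L_ε(t)`
    have hmin : min t (σ t) ≤ t := min_le_left _ _
    calc min (η ^ 6) c₇ ≤ η ^ 6 := min_le_left _ _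
      _ ≤ triLRCrossingProb t (7 * k) k :=
          hη t t hmin k hk (hkL hlt) 6 (7 * k) (by norm_num) (by omega)
  · -- super-critical side: RSW at `1/2` and monotonicity
    have hht : half ≤ t := Subtype.coe_le_coe.1 (by rw [coe_half]; exact hge)
    have hfloor : ⌊(7 : ℝ) * k⌋₊ = 7 * k := by
      rw [show (7 : ℝ) * k = ((7 * k : ℕ) : ℝ) by push_cast; ring, Nat.floor_natCast]
    have h1 : 1 ≤ ⌊(7 : ℝ) * k⌋₊ := by rw [hfloor]; omega
    have hP := (h₇ k h1).1
    rw [hfloor] at hP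
    calc min (η ^ 6) c₇ ≤ c₇ := min_le_right _ _
      _ ≤ triLRCrossingProb half (7 * k) k := hP
      _ ≤ triLRCrossingProb t (7 * k) k := TriHexExclusive.triLRCrossingProb_mono hht _ _

/-! ### Circuits in annuli at every density -/

/-- **Harris–FKG for the six crossings, at every density** (Bollobás–Riordan 2006, Ch. 7, proof of
Lemma 4): the probability under `P_p` that all six pieces of the hexagonal annulus at scale `k` are
crossed the long way is at least `P_p(LR(7k, k))⁶` (each piece is the image of `R(k, 7k)` under an
automorphism of `𝕋`, `P_p` is invariant under automorphisms, and the six events are increasing and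
local). The tree's `pow_six_le_real_iInter_isoTBCrossing` is the case `p = 1/2`; the proof is the
same. [cite: BollobasRiordan2006, Ch. 7 §7.2.1, proof of Lemma 4] -/
theorem pow_six_le_real_iInter_isoTBCrossing_at (p : unitInterval) (k : ℕ) :
    triLRCrossingProb p (7 * k) k ^ 6 ≤
      (triSitePercolation p).real (⋂ j < 6, isoTBCrossing (pieceIso k j) k (7 * k)) := by
  have h := sitePercolation_real_inter_iInter_ge p (V := Site 2) (F := box 2 (7 * k))
    (D := Set.univ) (Y := fun j => isoTBCrossing (pieceIso k j) k (7 * k)) (determinedBy_univ _)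
    isUpperSet_univ (N := 6)
    (fun j hj => (determinedBy_isoTBCrossing _ _ _).mono (piece_subset_box hj))
    (fun j _ => isUpperSet_isoTBCrossing _ _ _)
  rw [Set.univ_inter] at h
  have h1 : (sitePercolation (Site 2) p).real Set.univ = 1 := by simp
  rw [h1, one_mul] at h
  have h2 : ∀ j ∈ Finset.range 6, (sitePercolation (Site 2) p).real
      (isoTBCrossing (pieceIso k j) k (7 * k)) = triLRCrossingProb p (7 * k) k :=
    fun j _ => triSitePercolation_real_isoTBCrossing p (pieceIso k j) k (7 * k)
  rw [Finset.prod_congr rfl h2, Finset.prod_const, Finset.card_range] at h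
  exact h

/-- **RSW circuits in annuli at every density** (Bollobás–Riordan 2006, Ch. 7, §7.2.1, proof of
Lemma 4: "with probability at least `c⁶`, there is a closed cycle … separating the inner and outer
circles of the annulus"; here for open cycles under `P_p`): for `R ≥ 1000` and `k = ⌊7R/25⌋`,
`P_p(LR(7k, k))⁶ ≤ P_p(A(R, 2R))`, `A(R, 2R) = triOpenCircuit R (2R)` (an open circuit in the open
annulus `R < ‖·‖ < 2R` meeting every walk across it). The six long-way crossings of the pieces of
the hexagonal annulus `5k ≤ |·|_𝕋 ≤ 7k ⊆ {R < ‖·‖ < 2R}` contain such a circuit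
(`exists_circuit_of_crossings`, `mem_triOpenCircuit_of_circuit`). The tree's
`BollobasRiordan2006_openCircuit_of_rsw` is the case `p = 1/2`. [cite: BollobasRiordan2006, Ch. 7 §7.2.1, proof of Lemma 4] -/
theorem pow_six_le_real_triOpenCircuit (p : unitInterval) {R : ℝ} (hR : 1000 ≤ R) :
    triLRCrossingProb p (7 * ⌊(7 / 25 : ℝ) * R⌋₊) ⌊(7 / 25 : ℝ) * R⌋₊ ^ 6 ≤
      (triSitePercolation p).real (triOpenCircuit R (2 * R)) := by
  set k : ℕ := ⌊(7 / 25 : ℝ) * R⌋₊ with hk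
  have hk_le : (k : ℝ) ≤ 7 / 25 * R := Nat.floor_le (by positivity)
  have hk_gt : 7 / 25 * R < k + 1 := Nat.lt_floor_add_one _
  have hsqrt : (17 / 10 : ℝ) < Real.sqrt 3 := by
    rw [Real.lt_sqrt (by norm_num)]; norm_num
  have hk0 : (0 : ℝ) ≤ k := Nat.cast_nonneg k
  have hR1 : R < Real.sqrt 3 / 2 * (5 * k) := by nlinarith
  have hR2 : (7 * k : ℝ) < 2 * R := by linarith
  have hk1 : 1 ≤ k := by
    have : (1 : ℝ) ≤ 7 / 25 * R := by linarith
    exact Nat.le_floor (by exact_mod_cast this)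
  calc triLRCrossingProb p (7 * k) k ^ 6
      ≤ (triSitePercolation p).real (⋂ j < 6, isoTBCrossing (pieceIso k j) k (7 * k)) :=
        pow_six_le_real_iInter_isoTBCrossing_at p k
    _ ≤ (triSitePercolation p).real (triOpenCircuit R (2 * R)) := by
        refine measureReal_mono (fun ω hω => ?_) (measure_ne_top _ _)
        simp only [Set.mem_iInter] at hω
        obtain ⟨v, w, hw, h1⟩ := exists_circuit_of_crossings hk1 hω
        exact mem_triOpenCircuit_of_circuit hR1 hR2 w hw h1

/-- **Open circuits in annuli with probability bounded below, all `t`, below `L_ε(t)` on the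
sub-critical side** (Nolin 2008, §3.1, (3.6): "`P̂(∃ circuit in S_{N,2N}) ≥ δ₄⁴` for `N ≤ L(p)`";
Werner 2009, Lecture 6, §3): for `ε ∈ (0, 1/2)` there is `c > 0` with `c ≤ P_t(A(R, 2R))` for all
`t` and all `R ≥ 1000`, provided `R ≤ 3 L_ε(t)` when `t < 1/2` (then the scale `k = ⌊7R/25⌋` of the
six pieces is `< L_ε(t)`). [cite: Nolin2008, §3.1, (3.6)] [cite: BollobasRiordan2006, Ch. 7 §7.2.1, proof of Lemma 4] -/
theorem exists_pos_le_triOpenCircuit_nearCritical {ε : ℝ} (hε : 0 < ε) (hε' : ε < 1 / 2) :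
    ∃ c > (0 : ℝ), ∀ t : unitInterval, ∀ R : ℝ, 1000 ≤ R →
      ((t : ℝ) < 1 / 2 → R ≤ 3 * charLength ε t) →
        c ≤ (triSitePercolation t).real (triOpenCircuit R (2 * R)) := by
  obtain ⟨c, hc, h⟩ := exists_pos_le_triLRCrossingProb_seven hε hε'
  refine ⟨c ^ 6, by positivity, fun t R hR hRL => ?_⟩
  set k : ℕ := ⌊(7 / 25 : ℝ) * R⌋₊ with hk
  have hk_le : (k : ℝ) ≤ 7 / 25 * R := Nat.floor_le (by positivity)
  have hk1 : 1 ≤ k := by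
    have : (1 : ℝ) ≤ 7 / 25 * R := by linarith
    exact Nat.le_floor (by exact_mod_cast this)
  have hkL : (t : ℝ) < 1 / 2 → k < charLength ε t := by
    intro ht
    have hRL' := hRL ht
    have hLpos : (0 : ℝ) < charLength ε t := by linarith
    have : (k : ℝ) < charLength ε t := by linarith
    exact_mod_cast this
  calc c ^ 6 ≤ triLRCrossingProb t (7 * k) k ^ 6 := by gcongr; exact h t k hk1 hkL
    _ ≤ (triSitePercolation t).real (triOpenCircuit R (2 * R)) := pow_six_le_real_triOpenCircuit t hR

/-- **Open annulus crossings with probability bounded below, all `t`, below `L_ε(t)` on the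
sub-critical side** (Nolin 2008, §3.1, (3.5)): for `ε ∈ (0, 1/2)` there is `c > 0` with
`c ≤ P_t(C(b, 4b))` (`C = triOpenCrossing`: an open path from `‖·‖ < b` to `‖·‖ > 4b`) for all `t`
and all integers `b ≥ 6`, provided `b ≤ L_ε(t)` when `t < 1/2`: a top–bottom open crossing of
`R(b - 1, 7(b - 1))` crosses that annulus (`triTBCrossing_subset_triOpenCrossing`), and
`P_t(TB(k, 7k)) = P_t(LR(7k, k)) ≥ c` for `k = b - 1 < L_ε(t)`
(`exists_pos_le_triLRCrossingProb_seven`). The tree's `exists_pos_le_triOpenCrossing_four` is the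
case `t = 1/2`. [cite: Nolin2008, §3.1, (3.5)] -/
theorem exists_pos_le_triOpenCrossing_four_nearCritical {ε : ℝ} (hε : 0 < ε) (hε' : ε < 1 / 2) :
    ∃ c > (0 : ℝ), ∀ t : unitInterval, ∀ b : ℕ, 6 ≤ b → ((t : ℝ) < 1 / 2 → b ≤ charLength ε t) →
      c ≤ (triSitePercolation t).real (triOpenCrossing b (4 * b)) := by
  obtain ⟨c, hc, h⟩ := exists_pos_le_triLRCrossingProb_seven hε hε'
  refine ⟨c, hc, fun t b hb hbL => ?_⟩
  set k : ℕ := b - 1 with hk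
  have hk1 : 1 ≤ k := by omega
  have hkL : (t : ℝ) < 1 / 2 → k < charLength ε t := fun ht => by
    have := hbL ht; omega
  have hsub : triOpenCrossing ((k : ℝ) + 1) (6 * (k : ℝ)) ⊆ triOpenCrossing (b : ℝ) (4 * (b : ℝ)) := by
    refine triAnnulusCrossing_mono ?_ ?_
    · have : k + 1 = b := by omega
      exact_mod_cast this.le
    · have : 4 * b ≤ 6 * k := by omega
      exact_mod_cast this
  calc c ≤ triLRCrossingProb t (7 * k) k := h t k hk1 hkL
    _ = (triSitePercolation t).real (triTBCrossing k (7 * k)) :=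
        (triSitePercolation_real_triTBCrossing t k (7 * k)).symm
    _ ≤ (triSitePercolation t).real (triOpenCrossing ((k : ℝ) + 1) (6 * (k : ℝ))) :=
        measureReal_mono (triTBCrossing_subset_triOpenCrossing hk1) (measure_ne_top _ _)
    _ ≤ (triSitePercolation t).real (triOpenCrossing (b : ℝ) (4 * (b : ℝ))) :=
        measureReal_mono hsub (measure_ne_top _ _)

/-! ### The gluing with explicit RSW inputs -/

/-- **Quasi-multiplicativity of the one-arm event from RSW inputs at the same parameter** (Nolin
2008, §6.2, proof of Thm. 27, Case 1, eq. (6.6); LSW 2002, §3, p. 8: inclusion and Harris chain),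
the gluing of the tree's `triOneArm_quasiMult_euclid` with its five RSW inputs made explicit: if
under `P_t` the three open circuits `A(r, 2r)`, `r = a, 2a, 4a`, have probability `≥ cA` and the two
open crossings `C(b, 4b)`, `b = a, 2a`, probability `≥ cX`, then for `a ≥ 1000`, `R ≥ 8a`, `n ≤ R`,
`(cX cA)² cA · P_t(C(1, 2a)) · P_t(C(4a, R)) ≤ P_t(0 ↔ ∂Λ_n)`. [cite: Nolin2008, §6.2, proof of Thm. 27, Case 1, eq. (6.6) (arXiv 0711.4948: Thm. 26)] [cite: LawlerSchrammWernerEJP2002, §3 (p. 8)] -/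
theorem triOneArm_quasiMult_of_bounds (t : unitInterval) {a : ℕ} (ha : 1000 ≤ a) {R : ℝ}
    (hR : 8 * (a : ℝ) ≤ R) {n : ℕ} (hn : (n : ℝ) ≤ R) {cA cX : ℝ} (hcA : 0 ≤ cA) (hcX : 0 ≤ cX)
    (hA : ∀ r : ℝ, (a : ℝ) ≤ r → r ≤ 4 * a →
      cA ≤ (triSitePercolation t).real (triOpenCircuit r (2 * r)))
    (hX : ∀ b : ℕ, a ≤ b → b ≤ 2 * a →
      cX ≤ (triSitePercolation t).real (triOpenCrossing b (4 * b))) :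
    (cX * cA) * (cX * cA) * cA * ((triSitePercolation t).real (triOpenCrossing 1 (2 * a)) *
        (triSitePercolation t).real (triOpenCrossing (4 * a) R)) ≤
      (triSitePercolation t).real (triOneArm n) := by
  have ha0 : (0 : ℝ) < a := by exact_mod_cast (show 0 < a by omega)
  have ha' : (1000 : ℝ) ≤ a := by exact_mod_cast ha
  -- the events
  set D : Set (SiteConfig (Site 2)) := triOpenCrossing 1 (2 * a) with hDdef
  set Y : ℕ → Set (SiteConfig (Site 2)) := fun j =>
    if j = 0 then triOpenCrossing (a : ℝ) (4 * a) ∩ triOpenCircuit (a : ℝ) (2 * a)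
    else if j = 1 then triOpenCrossing (2 * (a : ℝ)) (8 * a) ∩ triOpenCircuit (2 * (a : ℝ)) (4 * a)
    else triOpenCrossing (4 * (a : ℝ)) R ∩ triOpenCircuit (4 * (a : ℝ)) (8 * a) with hYdef
  have hY0 : Y 0 = (triOpenCrossing (a : ℝ) (4 * a) ∩ triOpenCircuit (a : ℝ) (2 * a)) := by
    simp [hYdef]
  have hY1 : Y 1 = (triOpenCrossing (2 * (a : ℝ)) (8 * a) ∩ triOpenCircuit (2 * (a : ℝ)) (4 * a)) := by
    simp [hYdef]
  have hY2 : Y 2 = (triOpenCrossing (4 * (a : ℝ)) R ∩ triOpenCircuit (4 * (a : ℝ)) (8 * a)) := by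
    simp [hYdef]
  -- one finite set of sites determining everything
  set F : Finset (Site 2) := box 2 ⌈2 * (R + 1)⌉₊ with hF
  have hdetC : ∀ {R₁ R₂ : ℝ}, R₁ ≤ R₂ → R₂ ≤ R → DeterminedBy (triOpenCrossing R₁ R₂) ↑F :=
    fun hle hR₂ => (determinedBy_triOpenCrossing hle).mono
      (subset_box_of_norm_le fun v hv => hv.2.trans (by linarith))
  have hdetA : ∀ {R₁ R₂ : ℝ}, R₂ ≤ R → DeterminedBy (triOpenCircuit R₁ R₂) ↑F :=
    fun hR₂ => (determinedBy_triOpenCircuit _ _).mono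
      (subset_box_of_norm_le fun v hv => hv.2.le.trans (by linarith))
  have hdetD : DeterminedBy D ↑F := hdetC (by linarith) (by linarith)
  have hdetY : ∀ j < 3, DeterminedBy (Y j) ↑F := by
    intro j hj
    interval_cases j
    · rw [hY0]; exact (hdetC (by linarith) (by linarith)).inter (hdetA (by linarith))
    · rw [hY1]; exact (hdetC (by linarith) (by linarith)).inter (hdetA (by linarith))
    · rw [hY2]; exact (hdetC (by linarith) le_rfl).inter (hdetA (by linarith))
  have hupY : ∀ j < 3, IsUpperSet (Y j) := by
    intro j hj
    interval_cases j
    · rw [hY0]; exact (isUpperSet_triOpenCrossing _ _).inter (isUpperSet_triOpenCircuit _ _)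
    · rw [hY1]; exact (isUpperSet_triOpenCrossing _ _).inter (isUpperSet_triOpenCircuit _ _)
    · rw [hY2]; exact (isUpperSet_triOpenCrossing _ _).inter (isUpperSet_triOpenCircuit _ _)
  -- the inclusion
  have hincl : D ∩ ⋂ j < 3, Y j ⊆ triOneArm n := by
    rintro ω ⟨hωD, hωY⟩
    simp only [Set.mem_iInter] at hωY
    have h0 := hωY 0 (by norm_num); rw [hY0] at h0
    have h1 := hωY 1 (by norm_num); rw [hY1] at h1
    have h2 := hωY 2 (by norm_num); rw [hY2] at h2
    exact triOneArm_of_glue ha0 hR hn hωD h0 h1 h2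
  -- Harris chain under `P_t`
  have hchain := sitePercolation_real_inter_iInter_ge t (F := F) (D := D) (Y := Y) hdetD
    (isUpperSet_triOpenCrossing _ _) (N := 3) hdetY hupY
  -- lower bounds for the three middle factors
  have hPA : ∀ {r : ℝ}, (a : ℝ) ≤ r → r ≤ 4 * a →
      cA ≤ (sitePercolation (Site 2) t).real (triOpenCircuit r (2 * r)) := fun hr hr' => hA _ hr hr'
  have hPX : ∀ {b : ℕ}, a ≤ b → b ≤ 2 * a →
      cX ≤ (sitePercolation (Site 2) t).real (triOpenCrossing b (4 * b)) := fun hb hb' => hX _ hb hb'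
  have hb0 : cX * cA ≤ (sitePercolation (Site 2) t).real (Y 0) := by
    rw [hY0]
    calc cX * cA ≤ (sitePercolation (Site 2) t).real (triOpenCrossing (a : ℝ) (4 * a)) *
          (sitePercolation (Site 2) t).real (triOpenCircuit (a : ℝ) (2 * a)) :=
          mul_le_mul (hPX le_rfl (by omega)) (hPA le_rfl (by linarith)) hcA measureReal_nonneg
      _ ≤ _ := sitePercolation_harris t (hdetC (by linarith) (by linarith)) (hdetA (by linarith))
          (isUpperSet_triOpenCrossing _ _) (isUpperSet_triOpenCircuit _ _)
  have hb1 : cX * cA ≤ (sitePercolation (Site 2) t).real (Y 1) := by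
    rw [hY1]
    have h2a : ((2 * a : ℕ) : ℝ) = 2 * (a : ℝ) := by push_cast; ring
    have hx := hPX (b := 2 * a) (by omega) le_rfl
    rw [h2a, show (4 : ℝ) * (2 * (a : ℝ)) = 8 * a by ring] at hx
    calc cX * cA ≤ (sitePercolation (Site 2) t).real (triOpenCrossing (2 * (a : ℝ)) (8 * a)) *
          (sitePercolation (Site 2) t).real (triOpenCircuit (2 * (a : ℝ)) (4 * a)) :=
          mul_le_mul hx (by
            have := hPA (r := 2 * (a : ℝ)) (by linarith) (by linarith)
            rwa [show (2 : ℝ) * (2 * (a : ℝ)) = 4 * a by ring] at this) hcA measureReal_nonneg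
      _ ≤ _ := sitePercolation_harris t (hdetC (by linarith) (by linarith)) (hdetA (by linarith))
          (isUpperSet_triOpenCrossing _ _) (isUpperSet_triOpenCircuit _ _)
  have hb2 : (sitePercolation (Site 2) t).real (triOpenCrossing (4 * (a : ℝ)) R) * cA ≤
      (sitePercolation (Site 2) t).real (Y 2) := by
    rw [hY2]
    calc (sitePercolation (Site 2) t).real (triOpenCrossing (4 * (a : ℝ)) R) * cA
        ≤ (sitePercolation (Site 2) t).real (triOpenCrossing (4 * (a : ℝ)) R) *
          (sitePercolation (Site 2) t).real (triOpenCircuit (4 * (a : ℝ)) (8 * a)) :=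
          mul_le_mul_of_nonneg_left (by
            have := hPA (r := 4 * (a : ℝ)) (by linarith) le_rfl
            rwa [show (2 : ℝ) * (4 * (a : ℝ)) = 8 * a by ring] at this) measureReal_nonneg
      _ ≤ _ := sitePercolation_harris t (hdetC (by linarith) le_rfl) (hdetA (by linarith))
          (isUpperSet_triOpenCrossing _ _) (isUpperSet_triOpenCircuit _ _)
  -- assemble
  have hprod : ∏ j ∈ Finset.range 3, (sitePercolation (Site 2) t).real (Y j) =
      (sitePercolation (Site 2) t).real (Y 0) * (sitePercolation (Site 2) t).real (Y 1) *
        (sitePercolation (Site 2) t).real (Y 2) := by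
    simp [Finset.prod_range_succ]
  have hDn : 0 ≤ (sitePercolation (Site 2) t).real D := measureReal_nonneg
  have hcXA : 0 ≤ cX * cA := mul_nonneg hcX hcA
  calc cX * cA * (cX * cA) * cA * ((triSitePercolation t).real D *
        (triSitePercolation t).real (triOpenCrossing (4 * (a : ℝ)) R))
      = (sitePercolation (Site 2) t).real D * ((cX * cA) * (cX * cA) *
          ((sitePercolation (Site 2) t).real (triOpenCrossing (4 * (a : ℝ)) R) * cA)) := by
        show cX * cA * (cX * cA) * cA * ((sitePercolation (Site 2) t).real D *
          (sitePercolation (Site 2) t).real (triOpenCrossing (4 * (a : ℝ)) R)) = _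
        ring
    _ ≤ (sitePercolation (Site 2) t).real D * ((sitePercolation (Site 2) t).real (Y 0) *
          (sitePercolation (Site 2) t).real (Y 1) * (sitePercolation (Site 2) t).real (Y 2)) := by
        refine mul_le_mul_of_nonneg_left ?_ hDn
        have h01 : (cX * cA) * (cX * cA) ≤ (sitePercolation (Site 2) t).real (Y 0) *
            (sitePercolation (Site 2) t).real (Y 1) :=
          mul_le_mul hb0 hb1 hcXA measureReal_nonneg
        exact mul_le_mul h01 hb2 (mul_nonneg measureReal_nonneg hcA)
          (mul_nonneg measureReal_nonneg measureReal_nonneg)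
    _ = (sitePercolation (Site 2) t).real D *
          ∏ j ∈ Finset.range 3, (sitePercolation (Site 2) t).real (Y j) := by rw [hprod]
    _ ≤ (sitePercolation (Site 2) t).real (D ∩ ⋂ j < 3, Y j) := hchain
    _ ≤ (triSitePercolation t).real (triOneArm n) :=
        measureReal_mono hincl (measure_ne_top _ _)

/-! ### Quasi-multiplicativity and extendability below `L_ε`, on both sides of `1/2` -/

/-- **Quasi-multiplicativity of the one-arm event below `L_ε(t)`, on both sides of `1/2`** (Nolin
2008, §6.2, proof of Thm. 27, Case 1, eq. (6.6), with its footnote; §4.5, Prop. 17 [arXiv: Prop. 16]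
for `j = 1`, "uniformly in `P̂` between `P_p` and `P_{1-p}` and `N ≤ L(p)`"; Kesten 1987), Euclidean
form, for the homogeneous measures `P_t`: for `ε ∈ (0, 1/2)` there is `c > 0` such that for every
`t`, every integer `a ≥ 1000` with `2a ≤ L_ε(t)` if `t < 1/2`, every `R ≥ 8a` and `n ≤ R`,
`c · P_t(C(1, 2a)) · P_t(C(4a, R)) ≤ P_t(0 ↔ ∂Λ_n)` (the RSW inputs live at the scales `a, …, 8a`
only: `exists_pos_le_triOpenCircuit_nearCritical` at `r = a, 2a, 4a ≤ 2 L_ε(t)`,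
`exists_pos_le_triOpenCrossing_four_nearCritical` at `b = a, 2a ≤ L_ε(t)`). The tree's
`triOneArm_quasiMult_euclid` is the super-critical half (`t ≥ 1/2`, no restriction). [cite: Nolin2008, §6.2, proof of Thm. 27, Case 1, eq. (6.6) and footnote (arXiv 0711.4948: Thm. 26)] [cite: Nolin2008, §4.5, Prop. 17 (arXiv 0711.4948: Prop. 16), j = 1] -/
theorem triOneArm_quasiMult_euclid_nearCritical {ε : ℝ} (hε : 0 < ε) (hε' : ε < 1 / 2) :
    ∃ c > (0 : ℝ), ∀ t : unitInterval, ∀ a : ℕ, 1000 ≤ a →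
      ((t : ℝ) < 1 / 2 → 2 * a ≤ charLength ε t) →
        ∀ R : ℝ, 8 * (a : ℝ) ≤ R → ∀ n : ℕ, (n : ℝ) ≤ R →
          c * ((triSitePercolation t).real (triOpenCrossing 1 (2 * a)) *
              (triSitePercolation t).real (triOpenCrossing (4 * a) R)) ≤
            (triSitePercolation t).real (triOneArm n) := by
  obtain ⟨cA, hcA, hA⟩ := exists_pos_le_triOpenCircuit_nearCritical hε hε'
  obtain ⟨cX, hcX, hX⟩ := exists_pos_le_triOpenCrossing_four_nearCritical hε hε'
  refine ⟨(cX * cA) * (cX * cA) * cA, by positivity, fun t a ha haL R hR n hn => ?_⟩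
  have ha' : (1000 : ℝ) ≤ a := by exact_mod_cast ha
  refine triOneArm_quasiMult_of_bounds t ha hR hn hcA.le hcX.le (fun r hr hr' => ?_)
    (fun b hb hb' => ?_)
  · refine hA t r (by linarith) fun ht => ?_
    have h2 : ((2 * a : ℕ) : ℝ) ≤ charLength ε t := by exact_mod_cast haL ht
    push_cast at h2
    linarith
  · exact hX t b (by omega) fun ht => by have := haL ht; omega

/-- **Quasi-multiplicativity of the one-arm event with the hexagonal inner arm, below `L_ε(t)`, on
both sides of `1/2`** (Nolin 2008, §6.2, eq. (6.6), `j = 1`; Kesten 1987): for `ε ∈ (0, 1/2)` there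
is `c > 0` such that for all `t`, all integers `a ≥ 1000` with `2a ≤ L_ε(t)` if `t < 1/2`, all
`m ≥ 3a`, `R ≥ 8a` and `n ≤ R`, `c · P_t(0 ↔ ∂Λ_m) · P_t(C(4a, R)) ≤ P_t(0 ↔ ∂Λ_n)`
(`{0 ↔ ∂Λ_m} ⊆ C(1, 2a)` since `(√3/2) m > 2a`). The tree's `triOneArm_quasiMult` is the half
`t ≥ 1/2`. [cite: Nolin2008, §6.2, proof of Thm. 27, Case 1, eq. (6.6) (arXiv 0711.4948: Thm. 26)] -/
theorem triOneArm_quasiMult_nearCritical {ε : ℝ} (hε : 0 < ε) (hε' : ε < 1 / 2) :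
    ∃ c > (0 : ℝ), ∀ t : unitInterval, ∀ a : ℕ, 1000 ≤ a →
      ((t : ℝ) < 1 / 2 → 2 * a ≤ charLength ε t) → ∀ m : ℕ, 3 * a ≤ m →
        ∀ R : ℝ, 8 * (a : ℝ) ≤ R → ∀ n : ℕ, (n : ℝ) ≤ R →
          c * ((triSitePercolation t).real (triOneArm m) *
              (triSitePercolation t).real (triOpenCrossing (4 * a) R)) ≤
            (triSitePercolation t).real (triOneArm n) := by
  obtain ⟨c, hc, h⟩ := triOneArm_quasiMult_euclid_nearCritical hε hε'
  refine ⟨c, hc, fun t a ha haL m hm R hR n hn => le_trans ?_ (h t a ha haL R hR n hn)⟩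
  have hsqrt : (17 / 10 : ℝ) < Real.sqrt 3 := by
    rw [Real.lt_sqrt (by norm_num)]; norm_num
  have hm' : (3 : ℝ) * a ≤ m := by exact_mod_cast hm
  have ha0 : (0 : ℝ) < a := by exact_mod_cast (show 0 < a by omega)
  have h1 : Real.sqrt 3 / 2 * (3 * (a : ℝ)) ≤ Real.sqrt 3 / 2 * m :=
    mul_le_mul_of_nonneg_left hm' (by positivity)
  have h2 : (2 : ℝ) * a < Real.sqrt 3 / 2 * (3 * (a : ℝ)) := by
    nlinarith [mul_pos (sub_pos.2 hsqrt) ha0]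
  have hsub : triOneArm m ⊆ triOpenCrossing 1 (2 * (a : ℝ)) :=
    triOneArm_subset_triOpenCrossing one_pos (h2.trans_le h1)
  have hmono : (triSitePercolation t).real (triOneArm m) ≤
      (triSitePercolation t).real (triOpenCrossing 1 (2 * (a : ℝ))) :=
    measureReal_mono hsub (measure_ne_top _ _)
  have h0 : 0 ≤ (triSitePercolation t).real (triOpenCrossing (4 * (a : ℝ)) R) := measureReal_nonneg
  exact mul_le_mul_of_nonneg_left (mul_le_mul_of_nonneg_right hmono h0) hc.le

/-- **Extendability of the one-arm event below `L_ε(t)`, on both sides of `1/2`** (Nolin 2008,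
§4.5, Prop. 16 [arXiv: Prop. 15] for `j = 1`, "a direct consequence of RSW" (footnote in §6.2),
uniformly below `L(p)`; Werner 2009, Lecture 3): for `ε ∈ (0, 1/2)` there is `c > 0` such that
`c · P_t(0 ↔ ∂Λ_m) ≤ P_t(0 ↔ ∂Λ_n)` for all `t`, all integers `a ≥ 1000` with `4a ≤ L_ε(t)` if
`t < 1/2`, all `m ≥ 3a` and `n ≤ 8a` (the outer arm `C(4a, 8a) ⊇ C(4a, 16a)` of
`triOneArm_quasiMult_nearCritical` has probability `≥ c(ε)` by
`exists_pos_le_triOpenCrossing_four_nearCritical` at `b = 4a ≤ L_ε(t)`). The tree's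
`triOneArm_extend` is the half `t ≥ 1/2`. [cite: Nolin2008, §4.5, Prop. 16 (arXiv 0711.4948: Prop. 15), j = 1] -/
theorem triOneArm_extend_nearCritical {ε : ℝ} (hε : 0 < ε) (hε' : ε < 1 / 2) :
    ∃ c > (0 : ℝ), ∀ t : unitInterval, ∀ a : ℕ, 1000 ≤ a →
      ((t : ℝ) < 1 / 2 → 4 * a ≤ charLength ε t) → ∀ m n : ℕ, 3 * a ≤ m → n ≤ 8 * a →
        c * (triSitePercolation t).real (triOneArm m) ≤ (triSitePercolation t).real (triOneArm n) := by
  obtain ⟨c, hc, h⟩ := triOneArm_quasiMult_nearCritical hε hε'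
  obtain ⟨cX, hcX, hX⟩ := exists_pos_le_triOpenCrossing_four_nearCritical hε hε'
  refine ⟨c * cX, mul_pos hc hcX, fun t a ha haL m n hm hn => ?_⟩
  have hn' : (n : ℝ) ≤ 8 * (a : ℝ) := by exact_mod_cast hn
  have hmain := h t a ha (fun ht => by have := haL ht; omega) m hm (8 * a) le_rfl n hn'
  -- `P_t(C(4a, 8a)) ≥ P_t(C(4a, 16a)) ≥ cX`
  have h4a : ((4 * a : ℕ) : ℝ) = 4 * (a : ℝ) := by push_cast; ring
  have hsub : triOpenCrossing ((4 * a : ℕ) : ℝ) (4 * ((4 * a : ℕ) : ℝ)) ⊆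
      triOpenCrossing (4 * (a : ℝ)) (8 * (a : ℝ)) := by
    rw [h4a]
    exact triAnnulusCrossing_mono le_rfl (by have : (0 : ℝ) ≤ a := Nat.cast_nonneg a; linarith)
  have hXt : cX ≤ (triSitePercolation t).real (triOpenCrossing (4 * (a : ℝ)) (8 * (a : ℝ))) :=
    calc cX ≤ (triSitePercolation t).real (triOpenCrossing ((4 * a : ℕ) : ℝ) (4 * ((4 * a : ℕ) : ℝ))) :=
          hX t (4 * a) (by omega) fun ht => haL ht
      _ ≤ (triSitePercolation t).real (triOpenCrossing (4 * (a : ℝ)) (8 * (a : ℝ))) :=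
          measureReal_mono hsub (measure_ne_top _ _)
  have h1 : 0 ≤ (triSitePercolation t).real (triOneArm m) := measureReal_nonneg
  calc c * cX * (triSitePercolation t).real (triOneArm m)
      = c * ((triSitePercolation t).real (triOneArm m) * cX) := by ring
    _ ≤ c * ((triSitePercolation t).real (triOneArm m) *
          (triSitePercolation t).real (triOpenCrossing (4 * (a : ℝ)) (8 * (a : ℝ)))) :=
        mul_le_mul_of_nonneg_left (mul_le_mul_of_nonneg_left hXt h1) hc.le
    _ ≤ (triSitePercolation t).real (triOneArm n) := hmain

end Literature.Probability.Percolation
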